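import Literature.NumberTheory.GaloisRepresentations.WeilLAdicCharacterProofs
import Literature.NumberTheory.GaloisRepresentations.LAdicCharacterLocalGlobalProofs
import Literature.NumberTheory.GaloisRepresentations.IdelicCharacterRigidity
import Literature.NumberTheory.GaloisRepresentations.PadicEmbeddingCompletion
import Literature.NumberTheory.GaloisRepresentations.LocallyAlgebraicHeckeCharacterProofs
import HarnessLib

/-!
# The `ℓ`-adic avatar of an algebraic Hecke character and the local shape of Weil's character

Topic `NumberTheory/GaloisRepresentations`; namespace `Literature.NumberTheory.GaloisRepresentations`.
Proof file (definitions with bodies and theorems; no named fact, D-0026), a brick of the proof of the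
named fact `HeckeCharacter.exists_lAdic_isDeRhamFramed` (`WeilLAdicCharacterDeRham`, clause (ii):
Weil's character is de Rham above `ℓ`), following Serre, *Abelian ℓ-adic representations* (1968),
Ch. II §2.7 and Ch. III §2.3: the `ℓ`-adic character attached to an algebraic Hecke character is
LOCALLY ALGEBRAIC above `ℓ`, with an explicit algebraic part.

## Contents

Let `χ` be a Hecke character of the number field `K` of infinity type `(p, q)`
(`HasInfinityType`), `ι : ℚ̄_ℓ ≃+* ℂ`, `(T, e)` a modulus of definition (`IsModulus`) and
`r = hinf.weilRep hmod ι : Γ_K →ₜ* GL₁(ℚ̄_ℓ)` Weil's character (`WeilLAdicCharacterProofs`, `r = R⁻¹`).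

* §1–§2 `PadicEmbedding.algPart ι p q : 𝕀_K →* ℚ̄_ℓˣ`, `Λ(x) = ∏_{(v,e)} e(x_v)^{-n_{(v,e)}}` over the
  local embeddings `(v ∣ ℓ, e : K_v → ℚ̄_ℓ)` (`PadicEmbeddingCompletion`: `PlaceEmb K ℓ ≃ (K →+* ℚ̄_ℓ)`),
  `n_{(v,e)} = embExponent p q (ι ∘ e ∘ ι_v)`; continuous, `Λ(⟨z⟩_w) = 1` for `w ∤ ℓ`,
  `Λ((k)) = ∏_τ τ(k)^{-n_{ι∘τ}}`, `Λ(⟨y⟩_v) = ∏_{e : K_v → ℚ̄_ℓ} e(y)^{-n_{ι∘e∘ι_v}}` for `v ∣ ℓ`.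
* §3 **the `ℓ`-adic avatar** `HasInfinityType.lAdicAvatar : 𝕀_K →ₜ* ℚ̄_ℓˣ`,
  `ψ_ℓ(x) = ι⁻¹(χ(x) A_{p,q}(x_∞)⁻¹) · Λ(x)` (Weil's `χ_λ`, Serre II §2.7): continuous because
  `χ A⁻¹ = 1` near `1` (`eventually_unitaryRatio_eq_one`), trivial on `Kˣ`
  (`lAdicAvatarHom_principalIdele`: `A((k)_∞)⁻¹ = ∏_φ φ(k)^{n_φ}` and `ι⁻¹` reindexes `φ = ι ∘ τ`),
  and `ψ_ℓ(⟨z⟩_w) = ι⁻¹(χ(⟨z⟩_w))` for `w ∤ ℓ`.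
* §4 **`Ψ_r = ψ_ℓ⁻¹`** (`HasInfinityType.eq_lAdicAvatar_inv`): any idelic character of `r` with the
  clauses of `exists_idelicCharacter` is `ψ_ℓ⁻¹` — both are trivial on `Kˣ` and inverse to each other on
  `K_wˣ` for `w ∉ T`, `w ∤ ℓ` (`r(Frob_w) = ι⁻¹(χ(ϖ_w))⁻¹`), so the rigidity
  `ContinuousMonoidHom.idele_eq_of_forall_localUnits` (`IdelicCharacterRigidity`) applies; whence, by the
  local–global compatibility `exists_idelicCharacter_localGlobal` (`LAdicCharacterLocalGlobalProofs`),
  **`det r(res_v w) = ψ_ℓ(⟨a(w)⟩_v)`** for every place `v`, Artin map `a` (`IsLocalArtinMap`) and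
  `w ∈ W_{K_v}` (`det_weilRep_toAbsGalois`), and explicitly at `v ∣ ℓ`
  (`weilRep_toAbsGalois_apply`):

      r(res_v w)₀₀ = ι⁻¹(χ(⟨a(w)⟩_v)) · ∏_{e : K_v → ℚ̄_ℓ continuous} e(a(w))^{-n_{ι ∘ e ∘ ι_v}}

  — Serre's "`ρ_ℓ` is locally algebraic; the associated algebraic morphism is `x ↦ ∏_σ σ(x)^{-n_σ}`"
  (Ch. III §2.3 with §1.1), the first factor being of finite order on inertia.

## References

* [SerreAbelianLadic1968] J.-P. Serre, *Abelian ℓ-adic representations and elliptic curves* (1968),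
  Ch. II §2.7 (the `λ`-adic avatar `χ_λ`), Ch. III §1.1 (locally algebraic representations), §2.3
  (the representation attached to an algebraic Hecke character is locally algebraic).
* [Weil1956] A. Weil, *On a certain type of characters of the idèle-class group of an algebraic
  number-field* (1956), §1.
-/

noncomputable section

open scoped NumberField Topology Polynomial
open NumberField IsDedekindDomain IsDedekindDomain.HeightOneSpectrum Filter

namespace Literature.NumberTheory.GaloisRepresentations

variable {K : Type} [Field K] [NumberField K] {ℓ : ℕ} [Fact ℓ.Prime]


/-! ### §1. Components of ideles -/

/-- The component map `x ↦ x_v ∈ K_vˣ` is continuous. [folklore] -/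
theorem continuous_ideleCpt (v : HeightOneSpectrum (𝓞 K)) : Continuous (ideleCpt (K := K) v) := by
  refine Units.continuous_iff.mpr ⟨continuous_ideleGroup_snd_apply v, ?_⟩
  have : (fun x : ideleGroup K => (((ideleCpt v x)⁻¹ : (v.adicCompletion K)ˣ) : v.adicCompletion K)) =
      (fun x : ideleGroup K => (x : AdeleRing (𝓞 K) K).2 v) ∘ fun x => x⁻¹ := by
    funext x
    rw [Function.comp_apply, ideleGroup_val_inv_snd, Units.val_inv_eq_inv_val, val_ideleCpt]
  rw [this]
  exact (continuous_ideleGroup_snd_apply v).comp continuous_inv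

/-- The component at `w ≠ v` of `⟨z⟩_v` is `1`. [folklore] -/
theorem ideleCpt_localUnits_of_ne {v w : HeightOneSpectrum (𝓞 K)} (h : w ≠ v) (z : (v.adicCompletion K)ˣ) :
    ideleCpt w (localUnits v z) = 1 :=
  Units.ext (by rw [val_ideleCpt, localUnits_snd_apply_of_ne z h, Units.val_one])

/-- The component at `v` of `⟨z⟩_v` is `z`. [folklore] -/
@[simp] theorem ideleCpt_localUnits_self (v : HeightOneSpectrum (𝓞 K)) (z : (v.adicCompletion K)ˣ) :
    ideleCpt v (localUnits v z) = z :=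
  Units.ext (by rw [val_ideleCpt, localUnits_snd_apply_self])

/-- The infinite part of `⟨z⟩_v` is `1`. [folklore] -/
@[simp] theorem infPart_localUnits (v : HeightOneSpectrum (𝓞 K)) (z : (v.adicCompletion K)ˣ) :
    HeckeCharacter.infPart K (localUnits v z) = 1 :=
  Units.ext (localUnits_fst v z)

/-! ### §2. The `ℓ`-adic algebraic part `Λ(x) = ∏_{(v,e)} e(x_v)^{-n_{ι ∘ e ∘ ι_v}}` -/

namespace PadicEmbedding

/-- `PlaceEmb K ℓ` as a `Fintype` (it is finite, `PadicEmbeddingCompletion`). [folklore] -/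
instance instFintypePlaceEmb : Fintype (PlaceEmb K ℓ) := Fintype.ofFinite _

/-- Evaluation of an idele at a local embedding: `x ↦ e(x_v) ∈ ℚ̄_ℓˣ`. [folklore] -/
def PlaceEmb.eval (p : PlaceEmb K ℓ) : ideleGroup K →* (PadicAlgCl ℓ)ˣ :=
  (Units.map (p.2.1 : p.1.1.adicCompletion K →* PadicAlgCl ℓ)).comp (ideleCpt p.1.1)

/-- Unfolding. [folklore] -/
@[simp] theorem PlaceEmb.coe_eval (p : PlaceEmb K ℓ) (x : ideleGroup K) :
    (p.eval x : PadicAlgCl ℓ) = p.2.1 ((x : AdeleRing (𝓞 K) K).2 p.1.1) := rfl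

/-- `eval` is continuous. [folklore] -/
theorem PlaceEmb.continuous_eval (p : PlaceEmb K ℓ) : Continuous p.eval :=
  (Continuous.units_map _ p.2.2).comp (continuous_ideleCpt _)

/-- The exponent `n_{(v,e)} = n_{ι ∘ e ∘ ι_v}` of a local embedding in the infinity type `(p, q)`
transported along `ι : ℚ̄_ℓ ≃ ℂ`. [folklore] -/
def PlaceEmb.exponent (ι : PadicAlgCl ℓ ≃+* ℂ) (p q : InfinitePlace K → ℤ) (e : PlaceEmb K ℓ) : ℤ :=
  HeckeCharacter.embExponent p q ((ι : PadicAlgCl ℓ →+* ℂ).comp e.toEmbedding)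

variable (ι : PadicAlgCl ℓ ≃+* ℂ) (p q : InfinitePlace K → ℤ)

/-- **The `ℓ`-adic algebraic part** `Λ(x) = ∏_{(v,e)} e(x_v)^{-n_{(v,e)}}` of the avatar
(Serre's `∏_σ σ(x_ℓ)^{-n_σ}`, written through the local embeddings). [cite: SerreAbelianLadic1968, Ch. II §2.7, Ch. III §1.1] -/
def algPart : ideleGroup K →* (PadicAlgCl ℓ)ˣ :=
  ∏ e : PlaceEmb K ℓ, e.eval ^ (-(e.exponent ι p q))

/-- Unfolding. [folklore] -/
theorem algPart_apply (x : ideleGroup K) :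
    algPart ι p q x = ∏ e : PlaceEmb K ℓ, e.eval x ^ (-(e.exponent ι p q)) := by
  rw [algPart, MonoidHom.finsetProd_apply]
  rfl

/-- `Λ` is continuous. [folklore] -/
theorem continuous_algPart : Continuous (algPart (K := K) ι p q) := by
  have : (algPart ι p q : ideleGroup K → (PadicAlgCl ℓ)ˣ) = fun x => ∏ e : PlaceEmb K ℓ, e.eval x ^ (-(e.exponent ι p q)) :=
    funext (algPart_apply ι p q)
  rw [this]
  exact continuous_finsetProd _ fun e _ => (e.continuous_eval.zpow _)

/-- `Λ(⟨z⟩_w) = 1` at a place `w ∤ ℓ`. [folklore] -/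
theorem algPart_localUnits_of_not_mem {w : HeightOneSpectrum (𝓞 K)} (hw : ((ℓ : ℕ) : 𝓞 K) ∉ w.asIdeal)
    (z : (w.adicCompletion K)ˣ) : algPart ι p q (localUnits w z) = 1 := by
  rw [algPart_apply]
  refine Finset.prod_eq_one fun e _ => ?_
  have hne : (e.1.1 : HeightOneSpectrum (𝓞 K)) ≠ w := fun h => hw (h ▸ e.1.2)
  rw [PlaceEmb.eval, MonoidHom.comp_apply, ideleCpt_localUnits_of_ne hne, map_one, one_zpow]

/-- `Λ` on a principal idele: `Λ((k)) = ∏_τ τ(k)^{-n_{ι∘τ}}`. [folklore] -/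
theorem coe_algPart_principalIdele (k : Kˣ) :
    (algPart ι p q (principalIdele K k) : PadicAlgCl ℓ) =
      ∏ τ : K →+* PadicAlgCl ℓ, τ (k : K) ^ (-HeckeCharacter.embExponent p q ((ι : PadicAlgCl ℓ →+* ℂ).comp τ)) := by
  rw [algPart_apply, Units.coe_prod]
  rw [← Fintype.prod_equiv (placeEmbEquiv K ℓ) (fun e : PlaceEmb K ℓ => ((e.eval (principalIdele K k) ^ (-(e.exponent ι p q)) : (PadicAlgCl ℓ)ˣ) : PadicAlgCl ℓ))
    (fun τ => τ (k : K) ^ (-HeckeCharacter.embExponent p q ((ι : PadicAlgCl ℓ →+* ℂ).comp τ)))]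
  intro e
  rw [Units.val_zpow_eq_zpow_val, PlaceEmb.coe_eval, principalIdele_snd, placeEmbEquiv_apply]
  rfl

end PadicEmbedding

/-! ### §3. The `ℓ`-adic avatar `ψ_ℓ = ι⁻¹(χ · A_{p,q}⁻¹) · Λ` -/

namespace HeckeCharacter

open PadicEmbedding

variable (χ : HeckeCharacter K) (ι : PadicAlgCl ℓ ≃+* ℂ) (p q : InfinitePlace K → ℤ)

/-- `ι⁻¹ ∘ B`, `B = χ · A_{p,q}⁻¹` (locally constant when `χ` has infinity type `(p,q)`). [folklore] -/
def lAdicUnitaryRatio : ideleGroup K →* (PadicAlgCl ℓ)ˣ :=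
  (Units.map ((ι.symm : ℂ ≃+* PadicAlgCl ℓ) : ℂ →* PadicAlgCl ℓ)).comp (unitaryRatio χ p q)

/-- Unfolding. [folklore] -/
@[simp] theorem coe_lAdicUnitaryRatio_apply (x : ideleGroup K) :
    (lAdicUnitaryRatio χ ι p q x : PadicAlgCl ℓ) = ι.symm ((χ x : ℂ) * (archFactor p q (infPart K x))⁻¹) := by
  rw [← coe_unitaryRatio_apply]; rfl

/-- **The `ℓ`-adic avatar** `ψ_ℓ(x) = ι⁻¹(χ(x) A_{p,q}(x_∞)⁻¹) · ∏_{(v,e)} e(x_v)^{-n_{(v,e)}}` of a Hecke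
character of infinity type `(p, q)` (Weil's `χ_λ`, Serre's `ψ_ℓ`), as a homomorphism `𝕀_K → ℚ̄_ℓˣ`.
[cite: SerreAbelianLadic1968, Ch. II §2.7] [cite: Weil1956, §1] -/
def lAdicAvatarHom : ideleGroup K →* (PadicAlgCl ℓ)ˣ :=
  lAdicUnitaryRatio χ ι p q * algPart ι p q

/-- Unfolding. [folklore] -/
theorem coe_lAdicAvatarHom_apply (x : ideleGroup K) :
    (lAdicAvatarHom χ ι p q x : PadicAlgCl ℓ) =
      ι.symm ((χ x : ℂ) * (archFactor p q (infPart K x))⁻¹) * (algPart ι p q x : PadicAlgCl ℓ) := by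
  rw [lAdicAvatarHom, MonoidHom.mul_apply, Units.val_mul, coe_lAdicUnitaryRatio_apply]

variable {χ p q}

/-- `ψ_ℓ` is continuous when `χ` has infinity type `(p, q)`: near `1` it agrees with the continuous
`Λ` (`B = 1` there), and a homomorphism continuous at `1` is continuous. [folklore] -/
theorem HasInfinityType.continuous_lAdicAvatarHom (h : χ.HasInfinityType p q) :
    Continuous (lAdicAvatarHom χ ι p q) := by
  refine continuous_of_continuousAt_one (lAdicAvatarHom χ ι p q) ?_
  have key : (lAdicAvatarHom χ ι p q : ideleGroup K → (PadicAlgCl ℓ)ˣ) =ᶠ[𝓝 1] fun x => algPart ι p q x := by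
    filter_upwards [h.eventually_unitaryRatio_eq_one] with x hx
    rw [lAdicAvatarHom, MonoidHom.mul_apply, lAdicUnitaryRatio, MonoidHom.comp_apply, hx, map_one, one_mul]
  exact (continuous_algPart ι p q).continuousAt.congr key.symm

/-- **The `ℓ`-adic avatar as a continuous character `𝕀_K →ₜ* ℚ̄_ℓˣ`.** [cite: SerreAbelianLadic1968, Ch. II §2.7] -/
def HasInfinityType.lAdicAvatar (h : χ.HasInfinityType p q) (ι : PadicAlgCl ℓ ≃+* ℂ) :
    ideleGroup K →ₜ* (PadicAlgCl ℓ)ˣ :=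
  ⟨lAdicAvatarHom χ ι p q, h.continuous_lAdicAvatarHom ι⟩

/-- Unfolding. [folklore] -/
@[simp] theorem HasInfinityType.lAdicAvatar_apply (h : χ.HasInfinityType p q) (x : ideleGroup K) :
    h.lAdicAvatar ι x = lAdicAvatarHom χ ι p q x := rfl

/-- `ι⁻¹(∏_φ φ(k)^{m_φ}) = ∏_τ τ(k)^{m_{ι∘τ}}` (reindexing `φ = ι ∘ τ`). [folklore] -/
theorem map_prod_embedding_zpow_ιsymm (k : K) (m : (K →+* ℂ) → ℤ) :
    ι.symm (∏ φ : K →+* ℂ, φ k ^ m φ) =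
      ∏ τ : K →+* PadicAlgCl ℓ, τ k ^ m ((ι : PadicAlgCl ℓ →+* ℂ).comp τ) := by
  rw [map_prod]
  simp only [map_zpow₀]
  -- reindex along `τ ↦ ι ∘ τ`
  let E : (K →+* PadicAlgCl ℓ) ≃ (K →+* ℂ) :=
    { toFun := fun τ => (ι : PadicAlgCl ℓ →+* ℂ).comp τ
      invFun := fun φ => ((ι.symm : ℂ ≃+* PadicAlgCl ℓ) : ℂ →+* PadicAlgCl ℓ).comp φ
      left_inv := fun τ => RingHom.ext fun a => by simp
      right_inv := fun φ => RingHom.ext fun a => by simp }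
  rw [← Fintype.prod_equiv E (fun τ => τ k ^ m ((ι : PadicAlgCl ℓ →+* ℂ).comp τ)) (fun φ => ι.symm (φ k) ^ m φ)]
  intro τ
  change τ k ^ _ = ι.symm (ι (τ k)) ^ m ((ι : PadicAlgCl ℓ →+* ℂ).comp τ)
  rw [RingEquiv.symm_apply_apply]

/-- **`ψ_ℓ` kills the principal ideles**: `χ((k)) = 1`, `A((k)_∞)⁻¹ = ∏_φ φ(k)^{n_φ}`, and
`ι⁻¹(∏_φ φ(k)^{n_φ}) · ∏_τ τ(k)^{-n_{ι∘τ}} = 1`. [cite: SerreAbelianLadic1968, Ch. II §2.7] -/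
theorem lAdicAvatarHom_principalIdele (k : Kˣ) : lAdicAvatarHom χ ι p q (principalIdele K k) = 1 := by
  apply Units.ext
  rw [coe_lAdicAvatarHom_apply, χ.map_principal (principalIdele_mem k), Units.val_one, one_mul,
    infPart_principalIdele, archFactor_globalToInfiniteUnits_eq_prod_embeddings, coe_algPart_principalIdele,
    Units.val_one]
  rw [show (∏ φ : K →+* ℂ, φ (k : K) ^ (-embExponent p q φ))⁻¹ = ∏ φ : K →+* ℂ, φ (k : K) ^ embExponent p q φ by
    rw [← Finset.prod_inv_distrib]; exact Finset.prod_congr rfl fun φ _ => by rw [zpow_neg, inv_inv]]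
  rw [map_prod_embedding_zpow_ιsymm ι (k : K) (embExponent p q), ← Finset.prod_mul_distrib]
  refine Finset.prod_eq_one fun τ _ => ?_
  rw [← zpow_add₀ ((map_ne_zero τ).mpr k.ne_zero), add_neg_cancel, zpow_zero]

/-- `ψ_ℓ(x) = 1` for `x ∈ Kˣ`. [folklore] -/
theorem lAdicAvatarHom_eq_one_of_mem {x : ideleGroup K} (hx : x ∈ principalIdeles K) :
    lAdicAvatarHom χ ι p q x = 1 := by
  obtain ⟨k, rfl⟩ := hx
  exact lAdicAvatarHom_principalIdele ι k

/-- **`ψ_ℓ(⟨z⟩_w) = ι⁻¹(χ(⟨z⟩_w))` at a place `w ∤ ℓ`.** [folklore] -/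
theorem coe_lAdicAvatarHom_localUnits_of_not_mem {w : HeightOneSpectrum (𝓞 K)} (hw : ((ℓ : ℕ) : 𝓞 K) ∉ w.asIdeal)
    (z : (w.adicCompletion K)ˣ) :
    (lAdicAvatarHom χ ι p q (localUnits w z) : PadicAlgCl ℓ) = ι.symm (χ (localUnits w z) : ℂ) := by
  rw [coe_lAdicAvatarHom_apply, algPart_localUnits_of_not_mem ι p q hw, Units.val_one, mul_one, infPart_localUnits,
    map_one, inv_one, mul_one]

/-- Constructor of `PlaceEmb` (keeps the `PlaceEmb` type on the nose). [folklore] -/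
def _root_.Literature.NumberTheory.GaloisRepresentations.PadicEmbedding.PlaceEmb.mk'
    (v : HeightOneSpectrum (𝓞 K)) (hv : ((ℓ : ℕ) : 𝓞 K) ∈ v.asIdeal)
    (e : {e : v.adicCompletion K →+* PadicAlgCl ℓ // Continuous e}) : PlaceEmb K ℓ :=
  ⟨⟨v, hv⟩, e⟩

/-- `mk'` is injective in the embedding. [folklore] -/
theorem _root_.Literature.NumberTheory.GaloisRepresentations.PadicEmbedding.PlaceEmb.mk'_injective
    (v : HeightOneSpectrum (𝓞 K)) (hv : ((ℓ : ℕ) : 𝓞 K) ∈ v.asIdeal) :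
    Function.Injective (PlaceEmb.mk' (K := K) (ℓ := ℓ) v hv) := fun _ _ h =>
  eq_of_heq (Sigma.mk.inj h).2

/-- The local embeddings `K_v → ℚ̄_ℓ` (continuous) form a finite type. [folklore] -/
instance instFiniteLocalEmb (v : HeightOneSpectrum (𝓞 K)) :
    Finite {e : v.adicCompletion K →+* PadicAlgCl ℓ // Continuous e} := by
  by_cases hv : ((ℓ : ℕ) : 𝓞 K) ∈ v.asIdeal
  · exact Finite.of_injective (β := PlaceEmb K ℓ) _ (PlaceEmb.mk'_injective v hv)
  · exact @Finite.of_subsingleton _ ⟨fun e _ => absurd (natCast_mem_of_continuous e.1 e.2) hv⟩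

/-- The continuous local embeddings `K_v → ℚ̄_ℓ` as a `Fintype`. [folklore] -/
instance instFintypeLocalEmb (v : HeightOneSpectrum (𝓞 K)) :
    Fintype {e : v.adicCompletion K →+* PadicAlgCl ℓ // Continuous e} :=
  Fintype.ofFinite _

/-- **`Λ(⟨y⟩_v) = ∏_{e : K_v → ℚ̄_ℓ} e(y)^{-n_{ι∘e∘ι_v}}` at a place `v ∣ ℓ`** (only the local embeddings at `v`
see `⟨y⟩_v`). [folklore] -/
theorem coe_algPart_localUnits {v : HeightOneSpectrum (𝓞 K)} (hv : ((ℓ : ℕ) : 𝓞 K) ∈ v.asIdeal)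
    (y : (v.adicCompletion K)ˣ) :
    (algPart ι p q (localUnits v y) : PadicAlgCl ℓ) =
      ∏ e : {e : v.adicCompletion K →+* PadicAlgCl ℓ // Continuous e},
        e.1 (y : v.adicCompletion K) ^
          (-embExponent p q ((ι : PadicAlgCl ℓ →+* ℂ).comp (e.1.comp (algebraMap K (v.adicCompletion K))))) := by
  classical
  rw [algPart_apply, Units.coe_prod]
  -- split the product over the sigma type `PlaceEmb` according to the place
  have hsplit : ∀ e : PlaceEmb K ℓ, (e.1 : HeightOneSpectrum (𝓞 K)) ≠ v →
      (((e.eval (localUnits v y)) ^ (-(e.exponent ι p q)) : (PadicAlgCl ℓ)ˣ) : PadicAlgCl ℓ) = 1 := by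
    intro e he
    rw [PlaceEmb.eval, MonoidHom.comp_apply, ideleCpt_localUnits_of_ne he, map_one, one_zpow, Units.val_one]
  rw [← Finset.prod_subset (Finset.subset_univ (Finset.univ.filter fun e : PlaceEmb K ℓ => (e.1 : HeightOneSpectrum (𝓞 K)) = v))
    (fun e _ he => hsplit e (by simpa using he))]
  -- the remaining product is over the fibre at `v`, the image of the local embeddings at `v`
  have himage : (Finset.univ.filter fun e : PlaceEmb K ℓ => (e.1 : HeightOneSpectrum (𝓞 K)) = v) =
      Finset.univ.image (PlaceEmb.mk' (K := K) (ℓ := ℓ) v hv) := by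
    ext e
    rw [Finset.mem_filter, Finset.mem_image]
    simp only [Finset.mem_univ, true_and]
    constructor
    · intro h
      obtain ⟨⟨v', hv'⟩, f⟩ := e
      change v' = v at h
      subst h
      exact ⟨f, rfl⟩
    · rintro ⟨f, rfl⟩; rfl
  rw [himage, Finset.prod_image fun f _ f' _ h => PlaceEmb.mk'_injective v hv h]
  refine Finset.prod_congr rfl fun f _ => ?_
  rw [Units.val_zpow_eq_zpow_val, PlaceEmb.coe_eval]
  change f.1 ((((localUnits v y : ideleGroup K)) : AdeleRing (𝓞 K) K).2 v) ^ _ = _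
  rw [localUnits_snd_apply_self]
  rfl

end HeckeCharacter

/-! ### §4. `Ψ_r = ψ_ℓ⁻¹` and the local shape of Weil's character above `ℓ` -/

namespace HeckeCharacter

open PadicEmbedding

variable {χ : HeckeCharacter K} {ι : PadicAlgCl ℓ ≃+* ℂ} {T : Finset (HeightOneSpectrum (𝓞 K))}
  {e : HeightOneSpectrum (𝓞 K) → ℕ} {p q : InfinitePlace K → ℤ}

/-- A unit of valuation `1` of `K_v` comes from `𝒪_vˣ`. [folklore] -/
theorem exists_unitsMap_eq_of_valued_eq_one {v : HeightOneSpectrum (𝓞 K)} (u : (v.adicCompletion K)ˣ)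
    (hu : Valued.v (u : v.adicCompletion K) = 1) :
    ∃ w : (v.adicCompletionIntegers K)ˣ, Units.map ((v.adicCompletionIntegers K).subtype : _ →* _) w = u := by
  have hu' : Valued.v ((u⁻¹ : (v.adicCompletion K)ˣ) : v.adicCompletion K) = 1 := by
    rw [Units.val_inv_eq_inv_val, map_inv₀, hu, inv_one]
  exact ⟨⟨⟨(u : v.adicCompletion K), hu.le⟩, ⟨((u⁻¹ : (v.adicCompletion K)ˣ) : v.adicCompletion K), hu'.le⟩,
    Subtype.ext u.mul_inv, Subtype.ext u.inv_mul⟩, Units.ext rfl⟩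

variable (K ℓ) in
/-- The (finite) set of places of `K` above `ℓ`. [folklore] -/
def placesAbove : Finset (HeightOneSpectrum (𝓞 K)) :=
  (Ideal.finite_factors (I := (Ideal.span {((ℓ : ℕ) : 𝓞 K)} : Ideal (𝓞 K)))
    (by
      intro h
      rw [Ideal.zero_eq_bot, Ideal.span_singleton_eq_bot] at h
      exact (Fact.out : ℓ.Prime).ne_zero (by exact_mod_cast h))).toFinset

/-- `f⁻¹ x = (f x)⁻¹` for continuous monoid homs (definitional). [folklore] -/
private theorem cmh_inv_apply {G H : Type*} [Monoid G] [TopologicalSpace G] [CommGroup H] [TopologicalSpace H]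
    [IsTopologicalGroup H] (f : G →ₜ* H) (x : G) : f⁻¹ x = (f x)⁻¹ := rfl

/-- Membership in `placesAbove`. [folklore] -/
theorem mem_placesAbove_iff {v : HeightOneSpectrum (𝓞 K)} : v ∈ placesAbove K ℓ ↔ ((ℓ : ℕ) : 𝓞 K) ∈ v.asIdeal := by
  rw [placesAbove, Set.Finite.mem_toFinset, Set.mem_setOf_eq, Ideal.dvd_span_singleton]

/-- **`Ψ_r = ψ_ℓ⁻¹`**: an idelic character `Ψ` of Weil's `r = R⁻¹` (trivial on `Kˣ`, killing `𝒪_vˣ` and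
with `r(Frob_v) = Ψ(⟨ϖ_v⟩)` wherever `r` is unramified — the clauses of `exists_idelicCharacter`) is the
inverse of the `ℓ`-adic avatar: both are trivial on `Kˣ` and they are inverse on `K_wˣ` for every `w ∉ T`,
`w ∤ ℓ` (`r(Frob_w) = ι⁻¹(χ(ϖ_w))⁻¹`, `weilValue_frob`), so rigidity (`idele_eq_of_forall_localUnits`) applies.
[cite: SerreAbelianLadic1968, Ch. II §2.7, Ch. III §2.3] -/
theorem HasInfinityType.eq_lAdicAvatar_inv (hinf : χ.HasInfinityType p q) (hmod : IsModulus χ T e)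
    (ι : PadicAlgCl ℓ ≃+* ℂ) (hT : ∀ w, w ∉ T → χ.IsUnramifiedAt w) {Ψ : ideleGroup K →ₜ* (PadicAlgCl ℓ)ˣ}
    (hΨK : ∀ x ∈ principalIdeles K, Ψ x = 1)
    (hΨ : ∀ v : HeightOneSpectrum (𝓞 K), (hinf.weilRep hmod ι).IsUnramifiedAt v →
      (∀ u : (v.adicCompletionIntegers K)ˣ,
          Ψ (localUnits v (Units.map ((v.adicCompletionIntegers K).subtype : _ →* _) u)) = 1) ∧
      ∀ ϖ : (v.adicCompletion K)ˣ, Valued.v (ϖ : v.adicCompletion K) = WithZero.exp (-1 : ℤ) →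
        (hinf.weilRep hmod ι).HasFrobCharpolyAt v
          (Polynomial.X - Polynomial.C ((Ψ (localUnits v ϖ) : (PadicAlgCl ℓ)ˣ) : PadicAlgCl ℓ))) :
    Ψ = (hinf.lAdicAvatar ι)⁻¹ := by
  classical
  refine ContinuousMonoidHom.idele_eq_of_forall_localUnits Ψ _ hΨK
    (fun x hx => by rw [cmh_inv_apply, hinf.lAdicAvatar_apply, lAdicAvatarHom_eq_one_of_mem ι hx, inv_one])
    (S := T ∪ placesAbove K ℓ) fun w hw z => ?_
  rw [Finset.mem_union, not_or, mem_placesAbove_iff] at hw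
  obtain ⟨hwT, hwℓ⟩ := hw
  have hunr := hinf.isUnramifiedAt_weilRep hmod ι hwT hwℓ
  -- the valuation of `z`
  have hz0 : Valued.v (z : w.adicCompletion K) ≠ 0 := (Valuation.ne_zero_iff _).mpr z.ne_zero
  set m : ℤ := -WithZero.log (Valued.v (z : w.adicCompletion K)) with hm
  have hz : Valued.v (z : w.adicCompletion K) = WithZero.exp (-m) := by
    rw [hm, neg_neg, WithZero.exp_log hz0]
  -- `Ψ(⟨ϖ⟩) = ι⁻¹(χ(ϖ_w))⁻¹` by comparing Frobenius characteristic polynomials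
  set ϖ : (w.adicCompletion K)ˣ := uniformizer K w with hϖ
  have hϖv : Valued.v (ϖ : w.adicCompletion K) = WithZero.exp (-1 : ℤ) := valued_uniformizer w
  have hΨϖ : (Ψ (localUnits w ϖ) : PadicAlgCl ℓ) = (ι.symm (χ.valueAtUniformizer w))⁻¹ := by
    obtain ⟨𝔓, h𝔓⟩ := w.primesAbove_nonempty
    obtain ⟨Φ, hΦ⟩ := HeightOneSpectrum.exists_isArithFrobAt_of_mem_primesAbove_holds h𝔓
    have h1 := (FramedGaloisRep.hasFrobCharpolyAt_iff_of_rank_one _ w _).mp ((hΨ w hunr).2 ϖ hϖv) 𝔓 h𝔓 Φ hΦ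
    have h2 := (FramedGaloisRep.hasFrobCharpolyAt_iff_of_rank_one _ w _).mp
      (hinf.hasFrobCharpolyAt_weilRep hmod ι hwT hwℓ) 𝔓 h𝔓 Φ hΦ
    rw [← h1, h2, map_inv₀]
  -- `z = (z ϖ^{-m}) ϖ^m` with `z ϖ^{-m} ∈ 𝒪_wˣ`
  have hu : Valued.v ((z * ϖ ^ (-m) : (w.adicCompletion K)ˣ) : w.adicCompletion K) = 1 := by
    rw [Units.val_mul, Units.val_zpow_eq_zpow_val, map_mul, map_zpow₀, hz, hϖv, ← WithZero.exp_zsmul, smul_eq_mul,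
      ← WithZero.exp_add]
    convert WithZero.exp_zero using 2
    ring
  obtain ⟨u, hu'⟩ := exists_unitsMap_eq_of_valued_eq_one _ hu
  have hsplit : z = (z * ϖ ^ (-m)) * ϖ ^ m := by rw [mul_assoc, ← zpow_add, neg_add_cancel, zpow_zero, mul_one]
  -- the `Ψ` side
  have hΨz : (Ψ (localUnits w z) : PadicAlgCl ℓ) = ((ι.symm (χ.valueAtUniformizer w)) ^ m)⁻¹ := by
    rw [hsplit, map_mul, map_mul, ← hu', (hΨ w hunr).1 u, one_mul, map_zpow, map_zpow, Units.val_zpow_eq_zpow_val,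
      hΨϖ, inv_zpow]
  -- the avatar side
  have hAz : (((hinf.lAdicAvatar ι)⁻¹ (localUnits w z) : (PadicAlgCl ℓ)ˣ) : PadicAlgCl ℓ) =
      ((ι.symm (χ.valueAtUniformizer w)) ^ m)⁻¹ := by
    rw [cmh_inv_apply, Units.val_inv_eq_inv_val, hinf.lAdicAvatar_apply,
      coe_lAdicAvatarHom_localUnits_of_not_mem ι hwℓ, (hT w hwT).coe_map_localUnits_eq_zpow z hz, map_zpow₀]
  exact Units.ext (hΨz.trans hAz.symm)

/-- **The local shape of Weil's character: `det r(res w) = ψ_ℓ(⟨a(w)⟩_v)`** for every finite place `v`,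
every Artin map `a : W_{K_v} → K_vˣ` satisfying `IsLocalArtinMap`, and every `w ∈ W_{K_v}` — Weil's
character `r = R⁻¹` read through its idelic character (`exists_idelicCharacter_localGlobal`) and
`Ψ_r = ψ_ℓ⁻¹`. [cite: SerreAbelianLadic1968, Ch. III §2.3] -/
theorem HasInfinityType.det_weilRep_toAbsGalois (hinf : χ.HasInfinityType p q) (hmod : IsModulus χ T e)
    (ι : PadicAlgCl ℓ ≃+* ℂ) (hT : ∀ w, w ∉ T → χ.IsUnramifiedAt w) (v : HeightOneSpectrum (𝓞 K))
    (a : WeilGroup (v.adicCompletion K) →* (v.adicCompletion K)ˣ) (ha : IsLocalArtinMap (v.adicCompletion K) a)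
    (w : WeilGroup (v.adicCompletion K)) :
    FramedRep.det (hinf.weilRep hmod ι)
        (absGaloisRestrict K (v.adicCompletion K) (WeilGroup.toAbsGalois (v.adicCompletion K) w)) =
      hinf.lAdicAvatar ι (localUnits v (a w)) := by
  obtain ⟨Ψ, hΨK, hΨunr, hΨloc⟩ := FramedGaloisRep.exists_idelicCharacter_localGlobal (hinf.weilRep hmod ι)
  have hΨ := hinf.eq_lAdicAvatar_inv hmod ι hT hΨK hΨunr
  have h := hΨloc v a ha w
  rw [hΨ, cmh_inv_apply] at h
  exact (inv_injective h).symm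

/-- **Weil's character above `ℓ`, explicitly**: at a place `v ∣ ℓ`, for every Artin map `a` and
`w ∈ W_{K_v}`,
`r(res w) = ι⁻¹(χ(⟨a(w)⟩_v)) · ∏_{e : K_v → ℚ̄_ℓ} e(a(w))^{-n_{ι ∘ e ∘ ι_v}}`
— a character of finite order on inertia times the algebraic character of exponents `-n`
(Serre: "`ρ_ℓ` is locally algebraic, the associated algebraic morphism being `x ↦ ∏ σ(x)^{-n_σ}`").
[cite: SerreAbelianLadic1968, Ch. III §2.3, Ch. III §1.1] -/
theorem HasInfinityType.weilRep_toAbsGalois_apply (hinf : χ.HasInfinityType p q) (hmod : IsModulus χ T e)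
    (ι : PadicAlgCl ℓ ≃+* ℂ) (hT : ∀ w, w ∉ T → χ.IsUnramifiedAt w) {v : HeightOneSpectrum (𝓞 K)}
    (hv : ((ℓ : ℕ) : 𝓞 K) ∈ v.asIdeal)
    (a : WeilGroup (v.adicCompletion K) →* (v.adicCompletion K)ˣ) (ha : IsLocalArtinMap (v.adicCompletion K) a)
    (w : WeilGroup (v.adicCompletion K)) :
    ((hinf.weilRep hmod ι (absGaloisRestrict K (v.adicCompletion K) (WeilGroup.toAbsGalois (v.adicCompletion K) w)) :
        GL (Fin 1) (PadicAlgCl ℓ)) : Matrix (Fin 1) (Fin 1) (PadicAlgCl ℓ)) 0 0 =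
      ι.symm (χ (localUnits v (a w)) : ℂ) *
        ∏ f : {e : v.adicCompletion K →+* PadicAlgCl ℓ // Continuous e},
          f.1 ((a w : (v.adicCompletion K)ˣ) : v.adicCompletion K) ^
            (-embExponent p q ((ι : PadicAlgCl ℓ →+* ℂ).comp (f.1.comp (algebraMap K (v.adicCompletion K))))) := by
  have h := hinf.det_weilRep_toAbsGalois hmod ι hT v a ha w
  have h' := congrArg (fun u : (PadicAlgCl ℓ)ˣ => (u : PadicAlgCl ℓ)) h
  simp only [FramedRep.det_apply, Matrix.GeneralLinearGroup.val_det_apply, Matrix.det_fin_one] at h'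
  rw [h', hinf.lAdicAvatar_apply, coe_lAdicAvatarHom_apply, infPart_localUnits, map_one, inv_one, mul_one,
    coe_algPart_localUnits ι hv]

end HeckeCharacter



end Literature.NumberTheory.GaloisRepresentations

end
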